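import Summits.QuantumFields.YangMills.Theorems.LuscherReductionTwistedTraceScalingOneSiteInner
import HarnessLib

/-!
# ★★ THE ONE-SITE INNER WINDOW, `k`-UNIFORM: near-vacuum gauge-invariant families against the one-site levels, with NO input from crux ONE
# (lane A of S-BASE, crux `TwistedTraceScaling` stmt-QuantumFields-20203, line «twolattice», stub `stub_fixedLatticeTraceLaw`; brick W2 of the window floor W(L),
# card `pub/ym-fleet/ym-luscher-20007-p1/Lines-window-floor.md`; lead g24)

The SLOW input of the `k`-uniform Born–Oppenheimer window (brick W3) is the one-site twin of ✓`innerNoIntruderOneOrbitAt_one` WITHOUT its two uses of crux ONE (`μ_k ≥ μ₀/2`,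
`μ_k > 0` at level `k`, thresholds depending on `k`): for every `ε > 0` there is ONE threshold `B₀` such that for all `B ≥ B₀` and ALL levels `k`, every `(k+1)`-family of bounded
measurable GAUGE-invariant one-site functions supported in `{orbitDist < δ(B)}` (`δ ≤ 1/2` eventually; NOT twist-invariant) with nondegenerate Gram matrix has a nonzero combination `ψ`
with `⟨ψ, K_B ψ⟩ ≤ (μ_k(B) + ε·λ_b(B)·μ₀(B))·‖ψ‖²`.
Proof: twist-symmetrise (`twistSum`, physical; `‖·‖² × 8`, form `× 8` up to `56·crossBound·‖·‖²`), apply the upper Courant–Fischer door ✓`exists_coeff_rayleigh_lt_of_levelValue_lt` at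
`s = μ_k + (ε/2)λ_bμ₀ > μ_k = λ_k(B,1)` (strict because `λ_bμ₀ > 0` — no positivity of `μ_k` needed), and undo the eight copies with ✓`crossBound_eventually_small`
(`28·crossBound ≤ (ε/2)λ_b·λ₀(B,1)`, `k`-free).
* `oneSite_window_endgame` — the real arithmetic;
* ★★ `innerWindow_one` — the statement above.
HONEST FRAMING: a one-site (finite-dimensional) bookkeeping statement; it is the SLOW input of brick W3, not W(L); W(L), the stub S-BASE, `stub_cmpTwoLoop`, `stub_labelTracking` and the
crux `TwistedTraceScaling` stay OPEN; CONDITIONAL route R2b1; not infinite volume, not a mass gap, not Clay.  No definitions, no `sorry`.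
-/

set_option autoImplicit false

noncomputable section

open MeasureTheory Filter Topology Real
open scoped BigOperators
open Literature.MathematicalPhysics.QuantumFieldTheory
open Literature.MathematicalPhysics.QuantumLattice

namespace Summit.QuantumFields.YangMills.Theorems.FemtoTransferGap

/-! ## §1 The arithmetic -/

/-- Pure-real endgame: from `q_F ≤ s·(8 n_G)`, `8 q_G − 56 cB n_G ≤ q_F`, `28 cB ≤ η` (`η ≥ 0`, `n_G ≥ 0`) conclude `q_G ≤ (s + η)·n_G`. [folklore] -/
theorem oneSite_window_endgame {qF qG nG s cB η : ℝ} (hnG : 0 ≤ nG) (hη : 0 ≤ η) (hq : 8 * qG - 56 * (cB * nG) ≤ qF) (hF : qF ≤ s * (8 * nG))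
    (hsc : 28 * cB ≤ η) : qG ≤ (s + η) * nG := by
  have h1 : qG ≤ s * nG + 7 * (cB * nG) := by linarith
  have h7 : 7 * cB ≤ η := by linarith
  have h2 : 7 * (cB * nG) ≤ η * nG := by
    have := mul_le_mul_of_nonneg_right h7 hnG
    linarith
  linarith

/-! ## §2 ★★ The one-site inner window -/

set_option maxHeartbeats 400000 in
/-- ★★ **THE ONE-SITE INNER WINDOW, `k`-UNIFORM.**  For every scale `δ` with `δ B ≤ 1/2` eventually and every `ε > 0` there is `B₀` such that for all `B ≥ B₀` and ALL `k`: every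
`(k+1)`-family `G₀ … G_k` of bounded measurable gauge-invariant one-site functions supported in `{orbitDist < δ B}` with nondegenerate Gram matrix has a nonzero combination `ψ = Σ aᵢGᵢ`
with `⟨ψ, K_B ψ⟩ ≤ (μ_k(B) + ε·λ_b(B)·μ₀(B))·‖ψ‖²` (`μ_j(B) = levelValue su2Rep 1 B j`, `λ_b = bareLambda B`).  No input from crux ONE: the Courant–Fischer door is opened at
`s = μ_k + (ε/2)λ_bμ₀`, strictly above `λ_k(B,1) = μ_k` because `λ_bμ₀ > 0`. [cite: ReedSimonIV1978, Thm. XIII.1] [cite: Luscher1983, §2] -/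
theorem innerWindow_one {δ : ℝ → ℝ} (hδL : ∃ β1 : ℝ, ∀ β : ℝ, β1 ≤ β → δ β ≤ 1 / 2) :
    ∀ ε : ℝ, 0 < ε → ∃ β0 : ℝ, ∀ β : ℝ, β0 ≤ β → ∀ k : ℕ,
      ∀ G : Fin (k + 1) → (GaugeConfig 3 1 SU2 → ℝ),
        (∀ i, Measurable (G i)) → (∀ i, ∃ C : ℝ, ∀ U, |G i U| ≤ C) →
        (∀ i (g : Site 3 1 → SU2) (U : GaugeConfig 3 1 SU2), G i (gaugeTransform g U) = G i U) →
        (∀ i U, G i U ≠ 0 → orbitDist U < δ β) →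
        (∀ a : Fin (k + 1) → ℝ, a ≠ 0 → 0 < l2 (fun U => ∑ i, a i * G i U) (fun U => ∑ i, a i * G i U)) →
          ∃ a : Fin (k + 1) → ℝ, a ≠ 0 ∧
            qform su2Rep β (fun U => ∑ i, a i * G i U) (fun U => ∑ i, a i * G i U) ≤
              (levelValue su2Rep 1 β k + ε * bareLambda β * levelValue su2Rep 1 β 0) *
                l2 (fun U => ∑ i, a i * G i U) (fun U => ∑ i, a i * G i U) := by
  intro ε hε
  obtain ⟨β1, hδ1⟩ := hδL
  obtain ⟨βs, hs⟩ := crossBound_eventually_small (L := 1) (m := 1 / 2) (by norm_num) (half_pos hε)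
  refine ⟨max (max 1 β1) βs, fun β hβ k G hGm hGb hGg hGs hGram => ?_⟩
  have hβ1 : 1 ≤ β := ((le_max_left _ _).trans (le_max_left _ _)).trans hβ
  have hβ0 : 0 < β := by linarith
  have hβd : β1 ≤ β := ((le_max_right _ _).trans (le_max_left _ _)).trans hβ
  have hβs : βs ≤ β := (le_max_right _ _).trans hβ
  -- scales at one site: `L = 1`, `m = 1/2`
  have hδ2 : δ β ≤ 1 / 2 := hδ1 β hβd
  have hLδ : ((1 : ℕ) : ℝ) * δ β < 2 := by rw [Nat.cast_one, one_mul]; linarith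
  have hLm : ((1 : ℕ) : ℝ) * (δ β + 1 / 2) < 2 := by rw [Nat.cast_one, one_mul]; linarith
  have hB : ((1 : ℕ) : ℝ) ^ 3 * β = β := by rw [Nat.cast_one, one_pow, one_mul]
  -- one-site data
  have hμ0 : 0 < levelValue su2Rep 1 β 0 := levelValue_su2Rep_pos (L := 1) hβ0 0
  have hlam0 : 0 < bareLambda β := bareLambda_pos' hβ0
  have hsc : 28 * crossBound 1 β (1 / 2) ≤ ε / 2 * bareLambda β * levelValue su2Rep 1 β 0 := by
    have h := hs β hβs
    rw [hB] at h
    exact h.trans (mul_le_mul_of_nonneg_left (levelValue_zero_ge_uniform (L := 1) hβ1) (by positivity))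
  -- the physical family `F = twistSum ∘ G`
  choose C hC using hGb
  have hφm : ∀ a : Fin (k + 1) → ℝ, Measurable fun U => ∑ i, a i * G i U := fun a => Finset.measurable_sum _ fun i _ => (hGm i).const_mul _
  have hφb : ∀ (a : Fin (k + 1) → ℝ) U, |∑ i, a i * G i U| ≤ ∑ i, |a i| * C i := fun a U =>
    (Finset.abs_sum_le_sum_abs _ _).trans (Finset.sum_le_sum fun i _ => by rw [abs_mul]; exact mul_le_mul_of_nonneg_left (hC i U) (abs_nonneg _))
  have hφg : ∀ (a : Fin (k + 1) → ℝ) (g : Site 3 1 → SU2) U, (∑ i, a i * G i (gaugeTransform g U)) = ∑ i, a i * G i U := fun a g U =>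
    Finset.sum_congr rfl fun i _ => by rw [hGg]
  have hφs : ∀ (a : Fin (k + 1) → ℝ) U, ∑ i, a i * G i U ≠ 0 → orbitDist U < δ β := fun a U h => by
    by_contra hlt
    exact h (Finset.sum_eq_zero fun i _ => by
      have : G i U = 0 := by by_contra hi; exact hlt (hGs i U hi)
      rw [this, mul_zero])
  set F : Fin (k + 1) → GaugeConfig 3 1 SU2 → ℝ := fun i => twistSum (G i) with hFdef
  have hF : ∀ i, IsPhys (F i) := fun i => isPhys_twistSum (hGm i) ⟨C i, hC i⟩ (hGg i)
  have hcomb : ∀ a : Fin (k + 1) → ℝ, (fun U => ∑ i, a i * F i U) = twistSum (fun U => ∑ i, a i * G i U) := fun a => by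
    rw [twistSum_sum_mul]
  have hl2 : ∀ a : Fin (k + 1) → ℝ, l2 (fun U => ∑ i, a i * F i U) (fun U => ∑ i, a i * F i U) =
      8 * l2 (fun U => ∑ i, a i * G i U) (fun U => ∑ i, a i * G i U) := fun a => by
    rw [hcomb a]; exact l2_twistSum (hφm a) (hφb a) hLδ (hφs a)
  have hq : ∀ a : Fin (k + 1) → ℝ, 8 * qform su2Rep β (fun U => ∑ i, a i * G i U) (fun U => ∑ i, a i * G i U) -
      56 * (crossBound 1 β (1 / 2) * l2 (fun U => ∑ i, a i * G i U) (fun U => ∑ i, a i * G i U)) ≤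
        qform su2Rep β (fun U => ∑ i, a i * F i U) (fun U => ∑ i, a i * F i U) := fun a => by
    rw [hcomb a]
    have h := abs_qform_twistSum_sub_le hβ0.le (hφm a) (hφb a) (by norm_num : (0 : ℝ) ≤ 1 / 2) hLm (hφs a)
    rw [abs_le] at h
    linarith [h.1]
  have hFpos : ∀ a : Fin (k + 1) → ℝ, a ≠ 0 → 0 < l2 (fun U => ∑ i, a i * F i U) (fun U => ∑ i, a i * F i U) := fun a ha => by
    rw [hl2 a]; linarith [hGram a ha]
  -- the Courant–Fischer door at `s = μ_k + (ε/2)λ_bμ₀ > λ_k(β,1) = μ_k`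
  have hη : 0 < ε / 2 * bareLambda β * levelValue su2Rep 1 β 0 := by positivity
  have hks : levelValue su2Rep 1 β k < levelValue su2Rep 1 β k + ε / 2 * bareLambda β * levelValue su2Rep 1 β 0 := by linarith
  obtain ⟨a, ha, hlt⟩ := exists_coeff_rayleigh_lt_of_levelValue_lt hks F hF hFpos
  refine ⟨a, ha, ?_⟩
  rw [hl2 a] at hlt
  have hend := oneSite_window_endgame (l2_self_nonneg_lat _) hη.le (hq a) hlt.le hsc
  have e : levelValue su2Rep 1 β k + ε / 2 * bareLambda β * levelValue su2Rep 1 β 0 + ε / 2 * bareLambda β * levelValue su2Rep 1 β 0 =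
      levelValue su2Rep 1 β k + ε * bareLambda β * levelValue su2Rep 1 β 0 := by ring
  rw [e] at hend
  exact hend

end Summit.QuantumFields.YangMills.Theorems.FemtoTransferGap

end
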